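import Summits.ResolutionOfSingularities.ResolutionOfSingularities.Theorems.FrobeniusClosingSteerFreeChainCoordinates
import Literature.RingTheory.MvPowerSeries.MaximalIdealPow
import Mathlib.RingTheory.AdicCompletion.LocalRing
import Mathlib.FieldTheory.Perfect
import Mathlib.Algebra.CharP.Two
import HarnessLib

/-!
# Crux `Steer` (stmt-ResolutionOfSingularities-16345), chain W4.1, Lemma S kernel `…NoSatelliteStep`, stage (F) — small FRAME/RESIDUE helpers for the
# assembly (residue map along a dominated inclusion read in the completions; perfectness along a rational step; expansions map `𝔪^n` into `𝔪^n`;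
# the renormalised law at the next member)

OURS (campaign `res-hironaka`, rung L ★L-G4, slot W4.1; seat res-L0-w41-stub-2 g6 = Lemma S heir, res-L0-w41-plan-1 RULINGs 163a/181c; spec =
res-D-pv-007 `NoSatelliteStep-PLAN.md` stage (F); replaces the role of no printed item; NOT a statement of the manuscript under review [claim: Hironaka2017,
status: under-review]; AI-produced). Theses-free, definition-free.

* `NoSatelliteFrames.isLocalHom_inclusion` — a dominated inclusion of local subrings is a local homomorphism;
* `NoSatelliteFrames.exists_residue_hom` — for `S ≤ S'` dominated, Noetherian local: `λ : κ(Ŝ) →+* κ(Ŝ')` with `λ (res (s)) = res (s)` (the coefficient change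
  of the chart square, res-D-pv-007's `ExpansionTransport` input `hres`);
* `NoSatelliteFrames.exists_sq_eq_of_rational` — perfectness of `κ(S)` passes to `κ(S')` along a RATIONAL step (`hrat`);
* `NoSatelliteFrames.map_mem_pow_of_generators` — a ring hom `E : S → K⟦X⟧` with `E(x_i) = X_i` for generators `x_i` of `𝔪_S` maps `𝔪_S^n` into `𝔪^n`;
* `NoSatelliteFrames.renorm_law` — the renormalised law at the next member in characteristic `2`:
  `u^(2e) f₁ = (u^e g₁ + y^e (v^e u^e g₂))² + y^(2e) · ((v^e u^e)² (f₂ − g₂²))` from `f₂ · (y v)^(2e) = f₁ − g₁²`. [folklore]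
-/

noncomputable section

set_option linter.dupNamespace false

open IsLocalRing MvPowerSeries Literature.AlgebraicGeometry.Resolution Literature.RingTheory.MvPowerSeries

namespace Summit.ResolutionOfSingularities.ResolutionOfSingularities.Theorems.SwitchingDichotomy.NoSatelliteFrames

variable {L : Type} [Field L]

/-- A dominated inclusion of local subrings is a local homomorphism. [folklore] -/
theorem isLocalHom_inclusion {S S' : Subring L} [IsLocalRing S] [IsLocalRing S'] (hdom : SubringDominates S S') :
    IsLocalHom (Subring.inclusion hdom.1) := by
  refine ⟨fun a ha => ?_⟩
  rw [isUnit_subring_iff_inv_mem] at ha ⊢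
  rw [Subring.coe_inclusion] at ha
  exact ⟨ha.1, hdom.2 _ a.2 ha.2⟩

/-- **The coefficient change of the chart square.** For a dominated inclusion `S ≤ S'` of Noetherian local subrings there is a ring hom
`λ : κ(Ŝ) → κ(Ŝ')` of the residue fields of the COMPLETIONS compatible with `S → S'`: `λ (residue (s)) = residue (s)`. [folklore] -/
theorem exists_residue_hom {S S' : Subring L} [IsLocalRing S] [IsLocalRing S'] [IsNoetherianRing S] [IsNoetherianRing S']
    (hdom : SubringDominates S S') :
    ∃ lam : ResidueField (AdicCompletion (maximalIdeal S) S) →+* ResidueField (AdicCompletion (maximalIdeal S') S'),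
      ∀ s : S, lam (residue _ (algebraMap S (AdicCompletion (maximalIdeal S) S) s)) =
        residue _ (algebraMap S' (AdicCompletion (maximalIdeal S') S') (Subring.inclusion hdom.1 s)) := by
  haveI := isLocalHom_inclusion hdom
  haveI : IsLocalHom ((algebraMap S' (AdicCompletion (maximalIdeal S') S')).comp (Subring.inclusion hdom.1)) :=
    RingHom.isLocalHom_comp _ _
  let e₁ : ResidueField S ≃+* ResidueField (AdicCompletion (maximalIdeal S) S) :=
    RingEquiv.ofBijective _ (AdicCompletion.residueField_map_bijective S)
  refine ⟨(ResidueField.map ((algebraMap S' (AdicCompletion (maximalIdeal S') S')).comp (Subring.inclusion hdom.1))).comp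
    e₁.symm.toRingHom, fun s => ?_⟩
  have h1 : residue _ (algebraMap S (AdicCompletion (maximalIdeal S) S) s) = e₁ (residue S s) := by
    change _ = ResidueField.map (algebraMap S (AdicCompletion (maximalIdeal S) S)) (residue S s)
    rw [ResidueField.map_residue]
  rw [RingHom.comp_apply, h1, RingEquiv.toRingHom_eq_coe, RingHom.coe_coe, RingEquiv.symm_apply_apply, ResidueField.map_residue,
    RingHom.comp_apply]

/-- **Perfectness along a rational step**: if `κ(S)` is perfect (every element a square, characteristic `2`) and every element of `S'` is congruent
modulo `𝔪_{S'}` to an element of `S`, then every element of `κ(S')` is a square. [folklore] -/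
theorem exists_sq_eq_of_rational {S S' : Subring L} [IsLocalRing S] [IsLocalRing S'] (hdom : SubringDominates S S')
    (hperf : ∀ a : ResidueField S, ∃ b : ResidueField S, b ^ 2 = a)
    (hrat : ∀ z : S', ∃ s : S, z - Subring.inclusion hdom.1 s ∈ maximalIdeal S') :
    ∀ a : ResidueField S', ∃ b : ResidueField S', b ^ 2 = a := by
  intro a
  obtain ⟨z, rfl⟩ := residue_surjective a
  obtain ⟨s, hs⟩ := hrat z
  obtain ⟨b, hb⟩ := hperf (residue S s)
  obtain ⟨t, rfl⟩ := residue_surjective b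
  refine ⟨residue S' (Subring.inclusion hdom.1 t), ?_⟩
  have h1 : t ^ 2 - s ∈ maximalIdeal S := by rw [← residue_eq_zero_iff, map_sub, map_pow, hb, sub_self]
  have hts : Subring.inclusion hdom.1 (t ^ 2) - Subring.inclusion hdom.1 s ∈ maximalIdeal S' := by
    rw [← map_sub]; exact FreeChain.inclusion_mem_maximalIdeal hdom h1
  rw [← map_pow, ← sub_eq_zero, ← map_sub, residue_eq_zero_iff]
  have := Ideal.sub_mem _ hts hs
  rwa [sub_sub_sub_cancel_right] at this

/-- **An expansion adapted to generators maps `𝔪^n` into `𝔪^n`**: if `E : S → K⟦X⟧` sends a generating family `x` of `𝔪_S` to the variables, then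
`E(𝔪_S^n) ⊆ 𝔪_{K⟦X⟧}^n`. [folklore] -/
theorem map_mem_pow_of_generators {S : Type} [CommRing S] [IsLocalRing S] {K : Type} [Field K] {c : ℕ}
    (E : S →+* MvPowerSeries (Fin c) K) (x : Fin c → S) (hx : Ideal.span (Set.range x) = maximalIdeal S) (hE : ∀ i, E (x i) = X i)
    {n : ℕ} {s : S} (hs : s ∈ maximalIdeal S ^ n) : E s ∈ maximalIdeal (MvPowerSeries (Fin c) K) ^ n := by
  have hle : (maximalIdeal S).map E ≤ maximalIdeal (MvPowerSeries (Fin c) K) := by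
    rw [← hx, Ideal.map_span, Ideal.span_le]
    rintro _ ⟨_, ⟨i, rfl⟩, rfl⟩
    rw [hE]
    exact Jets.mem_maximalIdeal_iff_constantCoeff_eq_zero.mpr (constantCoeff_X i)
  have := Ideal.pow_right_mono (n := n) hle
  rw [← Ideal.map_pow] at this
  exact this (Ideal.mem_map_of_mem E hs)

/-- **The renormalised law at the next member** (characteristic `2`): from `f₂ · x₁^(2e) = f₁ − g₁²` and `x₁ = y · v`,
`u^(2e) · f₁ = (u^e g₁ + y^e (v^e u^e g₂))² + y^(2e) · ((v^e u^e)² · (f₂ − g₂²))`. [folklore] -/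
theorem renorm_law {R : Type*} [CommRing R] [CharP R 2] (f₁ g₁ f₂ g₂ x₁ y v u : R) (e : ℕ) (hlaw : f₂ * x₁ ^ (2 * e) = f₁ - g₁ ^ 2)
    (hx : x₁ = y * v) :
    u ^ (2 * e) * f₁ = (u ^ e * g₁ + y ^ e * (v ^ e * u ^ e * g₂)) ^ 2 + y ^ (2 * e) * ((v ^ e * u ^ e) ^ 2 * (f₂ - g₂ ^ 2)) := by
  rw [CharTwo.add_sq]
  have hf₁ : f₁ = g₁ ^ 2 + f₂ * (y * v) ^ (2 * e) := by rw [← hx, hlaw]; ring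
  rw [hf₁]
  ring

end Summit.ResolutionOfSingularities.ResolutionOfSingularities.Theorems.SwitchingDichotomy.NoSatelliteFrames

end
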